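import Literature.MathematicalPhysics.QuantumFieldTheory.Balaban1983to89.B2Sect3AGaussianStep

/-!
# `Balaban1983to89.B2Sect3BSchurStep` — [Balaban1982Higgs2] §3.B pp. 588–589: «(3.23) = Z(Ã^ε)exp(−½⟨Φ, Δ(Ã^ε)Φ⟩) (3.25)»
(the Gaussian integral over `φ₀↾_{Λ₅⁽⁰⁾}` of the exponent (3.23) is a Gaussian in the composite configuration Φ (3.24):
Schur complement) and the mechanism of (3.27) «⟨Φ, Δ(Ã^ε)Φ⟩ ≧ ⟨Φ, Δ′(Ã^ε)Φ⟩, because the inequality for the integrals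
holds for all Φ» — PROVED (theorems only)

statement-level skeleton of published theorems with citation tags; proofs where landed; nothing here is a claim about the Yang–Mills mass gap

CITATION HEADER.  T. Bałaban, *(Higgs)₂,₃ quantum fields in a finite volume. II. An upper bound*, Commun. Math. Phys.
**86** (1982) 555–594 [Balaban1982Higgs2] (cell paper B2; PDF held `paper:balaban1982-cmp86-higgs23-ii`, journal page =
PDF page + 554; pp. 588–589 READ AS IMAGES on the ×2 renders
`run/shared/lean/pub/pub-balaban/b2b-balaban-ref1/pages/1982-cmp86-higgs23-II/1982-cmp86-higgs23-II-p034-x2.png`, `…-p035-x2.png`).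
Unit `lit-balaban-p15` gen 2 (Phase-2 proof seat p15; HOME `run/shared/lean/pub/lit-balaban/`).  SKELETON rows **B2.Eq3.25**
((3.21)–(3.25); members (3.23)–(3.25) here — the compositions (3.21)–(3.22) are I (2.12) = r14's `B1RT.display212` /
`B1Eq214Concrete`, not restated) and **B2.Eq3.29** ((3.27)–(3.29); member (3.27) here — in the tree's `B2.prop31_of_decoupling`
(b2b unit pv07) (3.27) is the HYPOTHESIS `h327 : formN ≤ form`; this module PROVES the printed reason for it).  Fold owners
r02 / r14, §3 second reader r13, referee ref-4.

WHAT IS PRINTED (verbatim).  p. 588 [PDF 34]: *"Now let us consider the expression standing on the right of the characteristic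
functions. Its properties are essential for the whole analysis. Let us write it explicitly, omitting the constants in the
definition of renormalization transformations:
∫dφ₀↾_{Λ₅⁽⁰⁾} exp[−½Σ_{k=1}^{K} a_k(Lᵏε)^{d−2} Σ_{x_k∈Λ₅⁽ᵏ⁻¹⁾′∩Λ₅⁽ᵏ⁾ᶜ} |φ_k(x_k) − (Q_k(Ã^ε)φ₀)(x_k)|² − ½⟨φ₀, (−Δ^ε_{Ã^ε} + m²)φ₀⟩],
(3.23) where Λ₅⁽ᴷ⁾ = ∅. It is convenient to introduce the following new notations. We will consider a configuration Φ defined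
on the sum of sets Λ₅⁽⁰⁾ᶜ ∪ ⋃_{k=1}^{K}(Λ₅⁽ᵏ⁻¹⁾′∩Λ₅⁽ᵏ⁾ᶜ) by the formula Φ = Λ₅⁽⁰⁾ᶜφ₀ + Σ_{k=1}^{K}(Λ₅⁽ᵏ⁻¹⁾′∩Λ₅⁽ᵏ⁾ᶜ)φ_k, (3.24)"*;
p. 589 [PDF 35]: *"and we will write the integral (3.23) in the form (3.23) = Z(Ã^ε)exp(−½⟨Φ, Δ(Ã^ε)Φ⟩). (3.25) The properties
of the quadratic form in the above exponent are fundamental for further analysis."* … (proof of Proposition 3.1) *"We estimate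
the integral (3.23) by a similar integral with the covariant derivatives −½ε^d|(D^ε_{Ã^ε}φ₀)(b)|² replaced by 0 for all the
bonds b connecting the set Bᵏ(Λ₅⁽ᵏ⁾ᶜ) with Bᵏ(Λ₅⁽ᵏ⁾) for some k = 0, 1, …, K − 1. This inequality holds for an arbitrary
configuration Φ. If we denote the integral on the right side of the obtained inequality by Z′(Ã^ε)exp(−½⟨Φ, Δ′(Ã^ε)Φ⟩), then
we have ⟨Φ, Δ(Ã^ε)Φ⟩ ≧ ⟨Φ, Δ′(Ã^ε)Φ⟩, (3.27) because the inequality for the integrals holds for all Φ."*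

THE MODEL (schematic coordinates as in `…B2Sect3AGaussianStep` / `…B1GaussNorm331`, cell DIVERGENCE D-b01.3).  The
integration variable `ψ : ι → ℝ` (↤ `φ₀↾_{Λ₅⁽⁰⁾}` × components), Lebesgue measure; the composite external configuration
`ξ : K → ℝ` (↤ Φ of (3.24): `Λ₅⁽⁰⁾ᶜφ₀` and the `φ_k` on `Λ₅⁽ᵏ⁻¹⁾′∩Λ₅⁽ᵏ⁾ᶜ`, × components).  The exponent of (3.23) is a joint
quadratic form in `(ψ, ξ)`; its matrix blocks in these coordinates are `A : Matrix ι ι ℝ` (the `ψψ`-block: from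
`⟨φ₀,(−Δ_{Ã} + m²)φ₀⟩` and `Σa_k(Lᵏε)^{d−2}|Q_kφ₀|²` on Λ₅⁽⁰⁾), `B : Matrix ι K ℝ` (the `ψξ`-block) and `C : Matrix K K ℝ` (the
`ξξ`-block) — so the exponent is `−½[ψ⬝Aψ + 2ψ⬝Bξ + ξ⬝Cξ]`.  IN THESE COORDINATES (3.25) holds with
`Z(Ã^ε) = (2π)^{|ι|/2}[det A]^{−1/2}` (indeed independent of Φ) and `Δ(Ã^ε) = C − BᵀA⁻¹B` (the Schur complement); Δ′ is the
same with the blocks `A′, B′, C′` of the exponent with the connecting covariant derivatives dropped.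

WHAT THIS MODULE PROVES (kernel-checked, 0 `sorry`, standard axioms; THEOREMS ONLY).  §1 **(3.25)** `eq325` (the Schur-complement
evaluation, from the sibling's `integral_exp_quadratic_linear`, i.e. g13's `B9SectECov.integral_exp_source`), `eq325_rpow`
(printed `(2π)^{n/2}det^{−1/2}` shape), `integrable_exp323` (the integrand of (3.23) is integrable).  §2 `form_le_of_gaussian_le`
(**the printed reason for (3.27)**: if `Z₁e^{−½t²q₁} ≦ Z₂e^{−½t²q₂}` for all real `t` with `Z₁ > 0`, then `q₂ ≦ q₁` — scaling
`Φ ↦ tΦ`, `t → ∞`), `quadForm_smul` (`⟨tξ, M(tξ)⟩ = t²⟨ξ, Mξ⟩`).  §3 **(3.27)** `ineq327`: if the primed exponent is pointwise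
`≦` the unprimed one (*"replaced by 0"* some non-negative squares: *"This inequality holds for an arbitrary configuration Φ"*),
then `⟨ξ, Δ′ξ⟩ ≦ ⟨ξ, Δξ⟩` for every `ξ`, `Δ = C − BᵀA⁻¹B`, `Δ′ = C′ − B′ᵀA′⁻¹B′`; `ineq327_of_dropped` (the same with the
dropped part displayed as a non-negative form `P(ψ,ξ) ≧ 0`, unprimed = primed + P).
HONEST SCOPE.  (i) The operators `−Δ^ε_{Ã^ε} + m²`, `Q_k(Ã^ε)` and the sets are NOT constructed; A, B, C are the matrices of
the printed exponent in the integration coordinates (the displayed computation is an identity in them).  (ii) (3.26)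
(Proposition 3.1) and (3.28)–(3.29) are untouched (b2b's `B2.Prop31Printed`, `prop31_of_decoupling`, B4's Prop 3.1′).
(iii) An integral-free proof of (3.27) (Schur complement = minimum over ψ) exists; we follow the printed route.
-/

noncomputable section

open MeasureTheory Matrix Finset Real
open scoped BigOperators Matrix

namespace Literature.MathematicalPhysics.QuantumFieldTheory.Balaban1983to89.B2Sect3BSchurStep

open B2Sect3AGaussianStep

variable {ι K : Type*} [Fintype ι] [Fintype K] [DecidableEq ι]

/-! ## §1 (3.23) = (3.25): integrating `φ₀↾_{Λ₅⁽⁰⁾}` gives a Gaussian in Φ (Schur complement) -/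

omit [DecidableEq ι] in
/-- The exponent of (3.23) rearranged as «quadratic + linear + constant» in the integration variable:
`−½[ψ⬝Aψ + 2ψ⬝Bξ + ξ⬝Cξ] = −½ψ⬝Aψ + ⟨−Bξ, ψ⟩ − ½ξ⬝Cξ`. [cite: Balaban1982Higgs2, (3.23) p.588] -/
theorem exponent323_eq (A : Matrix ι ι ℝ) (B : Matrix ι K ℝ) (C : Matrix K K ℝ) (ξ : K → ℝ) (ψ : ι → ℝ) :
    -(1 / 2 : ℝ) * (ψ ⬝ᵥ A *ᵥ ψ + 2 * (ψ ⬝ᵥ (B *ᵥ ξ)) + ξ ⬝ᵥ (C *ᵥ ξ))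
      = -(1 / 2 : ℝ) * (ψ ⬝ᵥ A *ᵥ ψ) + (-(B *ᵥ ξ)) ⬝ᵥ ψ + -(1 / 2 : ℝ) * (ξ ⬝ᵥ (C *ᵥ ξ)) := by
  rw [neg_dotProduct, dotProduct_comm (B *ᵥ ξ) ψ]
  ring

/-- The integrand of (3.23) is integrable (`A` ↤ the `φ₀φ₀`-block, positive definite).
[cite: Balaban1982Higgs2, (3.23) p.588] -/
theorem integrable_exp323 {A : Matrix ι ι ℝ} (hA : A.PosDef) (B : Matrix ι K ℝ) (C : Matrix K K ℝ) (ξ : K → ℝ) :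
    Integrable fun ψ : ι → ℝ =>
      Real.exp (-(1 / 2 : ℝ) * (ψ ⬝ᵥ A *ᵥ ψ + 2 * (ψ ⬝ᵥ (B *ᵥ ξ)) + ξ ⬝ᵥ (C *ᵥ ξ))) := by
  have h := (B9SectECov.integrable_exp_source A hA (-(B *ᵥ ξ))).mul_const
    (Real.exp (-(1 / 2 : ℝ) * (ξ ⬝ᵥ (C *ᵥ ξ))))
  refine h.congr (Filter.Eventually.of_forall fun ψ => ?_)
  simp only
  rw [exponent323_eq, Real.exp_add, Real.exp_add, Real.exp_add]

/-- **(3.25)** p. 589: *"(3.23) = Z(Ã^ε)exp(−½⟨Φ, Δ(Ã^ε)Φ⟩)"* — in the coordinates of the module docstring,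
`∫dψ exp(−½[ψ⬝Aψ + 2ψ⬝Bξ + ξ⬝Cξ]) = √(2π)^{|ι|}/√(det A) · exp(−½ ξ⬝(C − BᵀA⁻¹B)ξ)`: `Z(Ã^ε) = √(2π)^{|ι|}/√det A`
(independent of Φ) and `Δ(Ã^ε) = C − BᵀA⁻¹B`, the Schur complement of the `φ₀↾_{Λ₅⁽⁰⁾}`-block.
[cite: Balaban1982Higgs2, (3.23)–(3.25) pp.588–589] -/
theorem eq325 {A : Matrix ι ι ℝ} (hA : A.PosDef) (B : Matrix ι K ℝ) (C : Matrix K K ℝ) (ξ : K → ℝ) :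
    ∫ ψ : ι → ℝ, Real.exp (-(1 / 2 : ℝ) * (ψ ⬝ᵥ A *ᵥ ψ + 2 * (ψ ⬝ᵥ (B *ᵥ ξ)) + ξ ⬝ᵥ (C *ᵥ ξ)))
      = Real.sqrt (2 * π) ^ Fintype.card ι / Real.sqrt A.det
          * Real.exp (-(1 / 2 : ℝ) * (ξ ⬝ᵥ ((C - Bᵀ * A⁻¹ * B) *ᵥ ξ))) := by
  simp_rw [exponent323_eq]
  rw [integral_exp_quadratic_linear hA]
  congr 2
  rw [neg_dotProduct, mulVec_neg, dotProduct_neg, neg_neg, sub_mulVec, dotProduct_sub, Matrix.mul_assoc,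
    ← mulVec_mulVec, ← mulVec_mulVec, dotProduct_adjointQ]
  ring

/-- (3.25) in the printed shape `Z = (2π)^{|ι|/2}[det A]^{−1/2}`. [cite: Balaban1982Higgs2, (3.25) p.589] -/
theorem eq325_rpow {A : Matrix ι ι ℝ} (hA : A.PosDef) (B : Matrix ι K ℝ) (C : Matrix K K ℝ) (ξ : K → ℝ) :
    ∫ ψ : ι → ℝ, Real.exp (-(1 / 2 : ℝ) * (ψ ⬝ᵥ A *ᵥ ψ + 2 * (ψ ⬝ᵥ (B *ᵥ ξ)) + ξ ⬝ᵥ (C *ᵥ ξ)))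
      = (2 * π) ^ ((Fintype.card ι : ℝ) / 2) * A.det ^ (-(1 / 2 : ℝ))
          * Real.exp (-(1 / 2 : ℝ) * (ξ ⬝ᵥ ((C - Bᵀ * A⁻¹ * B) *ᵥ ξ))) := by
  rw [eq325 hA, gaussConst_eq_rpow hA]

/-! ## §2 The printed reason for (3.27): an inequality of Gaussian integrals for all Φ forces the forms' inequality -/

omit [Fintype ι] [DecidableEq ι] in
/-- `⟨tξ, M(tξ)⟩ = t²⟨ξ, Mξ⟩`. [folklore] [cite: Balaban1982Higgs2, (3.27) p.589] -/
theorem quadForm_smul (M : Matrix K K ℝ) (t : ℝ) (ξ : K → ℝ) :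
    (t • ξ) ⬝ᵥ (M *ᵥ (t • ξ)) = t ^ 2 * (ξ ⬝ᵥ (M *ᵥ ξ)) := by
  rw [mulVec_smul, smul_dotProduct, dotProduct_smul, smul_eq_mul, smul_eq_mul]
  ring

omit [Fintype ι] [Fintype K] [DecidableEq ι] in
/-- **«because the inequality for the integrals holds for all Φ»** (p. 589, the reason for (3.27)), as a lemma on the
two Gaussians: if `Z₁e^{−½t²q₁} ≦ Z₂e^{−½t²q₂}` for every real `t` and `Z₁ > 0`, then `q₂ ≦ q₁` (take `Φ ↦ tΦ` and
`t → ∞`; with `e^x ≧ 1 + x` a single large `t` suffices). [cite: Balaban1982Higgs2, (3.27) p.589] -/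
theorem form_le_of_gaussian_le {Z₁ Z₂ q₁ q₂ : ℝ} (hZ₁ : 0 < Z₁)
    (h : ∀ t : ℝ, Z₁ * Real.exp (-(1 / 2 : ℝ) * (t ^ 2 * q₁)) ≤ Z₂ * Real.exp (-(1 / 2 : ℝ) * (t ^ 2 * q₂))) :
    q₂ ≤ q₁ := by
  by_contra hlt
  push Not at hlt
  -- Z₁(1 + ½t²(q₂ − q₁)) ≤ Z₂ for all t
  have key : ∀ t : ℝ, Z₁ * (1 + (1 / 2 : ℝ) * (t ^ 2 * (q₂ - q₁))) ≤ Z₂ := by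
    intro t
    have ht := h t
    have e₂ := Real.exp_pos (-(1 / 2 : ℝ) * (t ^ 2 * q₂))
    have hsplit : Real.exp (-(1 / 2 : ℝ) * (t ^ 2 * q₁))
        = Real.exp (-(1 / 2 : ℝ) * (t ^ 2 * q₂)) * Real.exp ((1 / 2 : ℝ) * (t ^ 2 * (q₂ - q₁))) := by
      rw [← Real.exp_add]; ring_nf
    rw [hsplit] at ht
    have h3 : Z₁ * Real.exp ((1 / 2 : ℝ) * (t ^ 2 * (q₂ - q₁))) ≤ Z₂ := by
      have : Z₁ * Real.exp ((1 / 2 : ℝ) * (t ^ 2 * (q₂ - q₁))) * Real.exp (-(1 / 2 : ℝ) * (t ^ 2 * q₂))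
          ≤ Z₂ * Real.exp (-(1 / 2 : ℝ) * (t ^ 2 * q₂)) := by linarith
      exact le_of_mul_le_mul_right this e₂
    have h4 := Real.add_one_le_exp ((1 / 2 : ℝ) * (t ^ 2 * (q₂ - q₁)))
    nlinarith
  -- choose t² = s with Z₁(1 + ½s(q₂ − q₁)) = 2Z₁ + Z₂ > Z₂
  set s : ℝ := 2 * (Z₁ + Z₂) / (Z₁ * (q₂ - q₁)) with hs
  have hZ₂ : 0 ≤ Z₂ := by
    have := key 0
    nlinarith
  have hs0 : 0 ≤ s := by rw [hs]; positivity
  have ht := key (Real.sqrt s)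
  rw [Real.sq_sqrt hs0, hs] at ht
  have e : Z₁ * (1 + (1 / 2 : ℝ) * (2 * (Z₁ + Z₂) / (Z₁ * (q₂ - q₁)) * (q₂ - q₁))) = 2 * Z₁ + Z₂ := by
    field_simp
    ring
  linarith

/-! ## §3 (3.27) -/

/-- **(3.27)** p. 589: *"We estimate the integral (3.23) by a similar integral with the covariant derivatives … replaced by
0 … This inequality holds for an arbitrary configuration Φ. If we denote the integral on the right side … by
Z′(Ã^ε)exp(−½⟨Φ, Δ′(Ã^ε)Φ⟩), then we have ⟨Φ, Δ(Ã^ε)Φ⟩ ≧ ⟨Φ, Δ′(Ã^ε)Φ⟩, (3.27) because the inequality for the integrals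
holds for all Φ."*  In coordinates: if the primed joint exponent is pointwise `≦` the unprimed one (`A, A′` positive
definite), then `⟨ξ, (C′ − B′ᵀA′⁻¹B′)ξ⟩ ≦ ⟨ξ, (C − BᵀA⁻¹B)ξ⟩` for every `ξ`. [cite: Balaban1982Higgs2, (3.27) p.589] -/
theorem ineq327 {A A' : Matrix ι ι ℝ} (hA : A.PosDef) (hA' : A'.PosDef) (B B' : Matrix ι K ℝ) (C C' : Matrix K K ℝ)
    (hle : ∀ (ψ : ι → ℝ) (ξ : K → ℝ),
      ψ ⬝ᵥ A' *ᵥ ψ + 2 * (ψ ⬝ᵥ (B' *ᵥ ξ)) + ξ ⬝ᵥ (C' *ᵥ ξ) ≤ ψ ⬝ᵥ A *ᵥ ψ + 2 * (ψ ⬝ᵥ (B *ᵥ ξ)) + ξ ⬝ᵥ (C *ᵥ ξ))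
    (ξ : K → ℝ) :
    ξ ⬝ᵥ ((C' - B'ᵀ * A'⁻¹ * B') *ᵥ ξ) ≤ ξ ⬝ᵥ ((C - Bᵀ * A⁻¹ * B) *ᵥ ξ) := by
  have hZ₁ : 0 < Real.sqrt (2 * π) ^ Fintype.card ι / Real.sqrt A.det :=
    div_pos (pow_pos (Real.sqrt_pos.2 (by positivity)) _) (Real.sqrt_pos.2 hA.det_pos)
  refine form_le_of_gaussian_le hZ₁ (Z₂ := Real.sqrt (2 * π) ^ Fintype.card ι / Real.sqrt A'.det) fun t => ?_
  -- the two integrals at the configuration tΦ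
  have h1 := eq325 hA B C (t • ξ)
  have h2 := eq325 hA' B' C' (t • ξ)
  rw [quadForm_smul (C - Bᵀ * A⁻¹ * B)] at h1
  rw [quadForm_smul (C' - B'ᵀ * A'⁻¹ * B')] at h2
  rw [← h1, ← h2]
  refine integral_mono_of_nonneg (Filter.Eventually.of_forall fun ψ => (Real.exp_pos _).le)
    (integrable_exp323 hA' B' C' (t • ξ)) (Filter.Eventually.of_forall fun ψ => ?_)
  have := hle ψ (t • ξ)
  exact Real.exp_le_exp.mpr (by linarith)

/-- (3.27) with the dropped part displayed: if the unprimed exponent is the primed one plus a non-negative form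
`P(ψ, ξ) ≧ 0` (↤ `Σ_b ½ε^d|(D^ε_{Ã^ε}φ₀)(b)|²` over the connecting bonds, *"replaced by 0"*), then `⟨ξ, Δ′ξ⟩ ≦ ⟨ξ, Δξ⟩`.
[cite: Balaban1982Higgs2, (3.27) p.589] -/
theorem ineq327_of_dropped {A A' : Matrix ι ι ℝ} (hA : A.PosDef) (hA' : A'.PosDef) (B B' : Matrix ι K ℝ)
    (C C' : Matrix K K ℝ) (P : (ι → ℝ) → (K → ℝ) → ℝ) (hP : ∀ ψ ξ, 0 ≤ P ψ ξ)
    (hsplit : ∀ (ψ : ι → ℝ) (ξ : K → ℝ),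
      ψ ⬝ᵥ A *ᵥ ψ + 2 * (ψ ⬝ᵥ (B *ᵥ ξ)) + ξ ⬝ᵥ (C *ᵥ ξ)
        = ψ ⬝ᵥ A' *ᵥ ψ + 2 * (ψ ⬝ᵥ (B' *ᵥ ξ)) + ξ ⬝ᵥ (C' *ᵥ ξ) + P ψ ξ)
    (ξ : K → ℝ) :
    ξ ⬝ᵥ ((C' - B'ᵀ * A'⁻¹ * B') *ᵥ ξ) ≤ ξ ⬝ᵥ ((C - Bᵀ * A⁻¹ * B) *ᵥ ξ) :=
  ineq327 hA hA' B B' C C' (fun ψ ξ' => by rw [hsplit ψ ξ']; linarith [hP ψ ξ']) ξ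

end Literature.MathematicalPhysics.QuantumFieldTheory.Balaban1983to89.B2Sect3BSchurStep
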